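import Literature.AnabelianGeometry.EtaleTheta.SettingModelChiCyclotomes
import Literature.AnabelianGeometry.EtaleTheta.SettingModelChiThetaCusp
import HarnessLib

/-!
# The χ-twisted root model WITH A CUSP (R78 F5c `ThetaSetting.modelχ′`), row #5: the cyclotome identifications
# `μ_N ≅ (l·Δ_Θ) ⊗ ℤ/Nℤ`, a `CyclotomeTower`, and `IsCompact Δ_Θ` — transported VERBATIM from `modelχ`

Mochizuki, *The Étale Theta Function …* [EtTh], Publ. RIMS **45** (2009), §1 p. 12 «(`Ẑ(1) ≅`) `Δ_Θ`», §2 p. 46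
«the natural isomorphism `μ_N ≅ (l·Δ_Θ) ⊗ (ℤ/Nℤ)`», Cor. 2.19 (ii) p. 64 (PRIMS PDF pages).  Cell abc-iut, layer
L2, seat abc-iut-L2-t8 (R78 row #5 «t8 adapter layer at the χ-twisted model»; GAP-LEDGER G-L2t10-1 / G-w5d187-1).
PROOF-ONLY (0 definitions).

abc-iut-w5-d029's `ThetaSetting.modelχ′ p` (`SettingModelChiThetaCusp.lean`, F5c) is abc-iut-L2-t1's `modelχ p`
transcribed over `curveχ′` = the SAME `Π^tp_X = Γ ⋊_χ G_{ℚ_p}`, `aug`, `Π_X`, theta quotients (abc-iut-L2-d1's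
`CurveTheta` package; `thetaKer_curveχ′_eq : … = … := rfl`) plus ONE synthetic cusp.  Hence every row-#5 result at
`modelχ` (`SettingModelChiCyclotomes.lean`, over abc-iut-L6-d6's `Ẑ`-coordinates `deltaThetaCoordχ`) holds at
`modelχ′` — the topological facts BY DEFINITIONAL TRANSPORT, the `D`-indexed structures by re-running the
row-#5 engine on the same coordinates: `t2Space_deltaTheta_modelχ′`, `isCompact_deltaTheta_modelχ′`,
`modelχ′_exists_cyclotomeMod_family`, `modelχ′_nonempty_cyclotomeMod`, `modelχ′_nonempty_cyclotomeTower`, and the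
joint-satisfiability capstone now INCLUDING A CUSP:
`exists_isEtThOrigin_and_isCusp_and_hYcl_and_isCompact_and_cyclotomeTower` — one theta setting with the guard, a
cusp, `hYcl`, `IsCompact Δ_Θ`, `aug` open, `CyclotomeMod l N` at every level and a `CyclotomeTower l E` over every
cofinal chain (the standing non-Kummer hypotheses of the §2 / [IUTchII]-side chains together with the cusp datum
the §2 label/inertia rows start from).  HONEST LABEL: semi-synthetic model (the cusp is the Tate-twisted `b`-axis,
abc-iut-w5-d029) — consistency evidence for the typed interface; nothing of [EtTh] asserted; no side taken on
[IUTchIII] Cor. 3.12; typed ≠ endorsed.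
-/

noncomputable section

namespace Literature.AnabelianGeometry.EtaleTheta.SettingModel

open Literature.AnabelianGeometry.SemiGraphs

variable (p : ℕ) [Fact p.Prime]

/-- `Δ_Θ` of `modelχ′` is Hausdorff (same theta quotient as `modelχ`). [cite: MochizukiEtTh2009, §1 p.12] -/
theorem t2Space_deltaTheta_modelχ' : T2Space ↥(ThetaSetting.modelχ' p).DeltaTheta :=
  t2Space_deltaTheta_modelχ p

/-- **`Δ_Θ` of `modelχ′` is COMPACT** (GAP G-w5d187-1's binder at the cusped model).
[cite: MochizukiEtTh2009, §1 p.12] -/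
theorem isCompact_deltaTheta_modelχ' :
    IsCompact ((ThetaSetting.modelχ' p).DeltaTheta : Set (ThetaSetting.modelχ' p).GtpTheta) :=
  isCompact_deltaTheta_modelχ p

/-- **`μ_N ≅ (l·Δ_Θ) ⊗ ℤ/Nℤ` at ALL levels, compatibly, at `modelχ′`** (`l ≥ 1`; the row-#5 engine
`exists_cyclotomeMod_family_of_chiTwist_inv` run at `modelχ′` on the same coordinates `deltaThetaCoordχ`).
[cite: MochizukiEtTh2009, Def 2.13 (ii) p.48] -/
theorem modelχ'_exists_cyclotomeMod_family {l : ℕ} (hl : 0 < l) :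
    ∃ mods : ∀ N : ℕ+, (ThetaSetting.modelχ' p).CyclotomeMod l N,
      ∀ (M M' : ℕ+) (h : (M : ℕ) ∣ (M' : ℕ)) (x : ↥((ThetaSetting.modelχ' p).lDeltaTheta l)),
        MuN.red p M M' h ((mods M').red x) = (mods M).red x := by
  haveI := t2Space_deltaTheta_modelχ' p
  -- `(modelχ′ p).DeltaTheta` is DEFINITIONALLY `Ker (CurveTheta.thetaToEll (curveχ p))` (same `Π^tp_X`, same
  -- theta-quotient kernels: `thetaKer_curveχ'_eq` is `rfl`), so abc-iut-L6-d6's coordinates and their χ-law at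
  -- `modelχ` are accepted verbatim by unification (no instance search on mixed carriers).
  exact (ThetaSetting.modelχ' p).exists_cyclotomeMod_family_of_chiTwist_inv hl (deltaThetaCoordχ p)
    (continuous_deltaThetaCoordχ p) (bijective_deltaThetaCoordχ p)
    (fun g t => conjNormal_toTheta_deltaThetaCoordχ p g t)

/-- **`CyclotomeMod l N` is INHABITED at `modelχ′`** (every `l ≥ 1`, every `N`). [cite: MochizukiEtTh2009, §2 p.46] -/
theorem modelχ'_nonempty_cyclotomeMod {l : ℕ} (hl : 0 < l) (N : ℕ+) :
    Nonempty ((ThetaSetting.modelχ' p).CyclotomeMod l N) := by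
  obtain ⟨mods, -⟩ := modelχ'_exists_cyclotomeMod_family p hl
  exact ⟨mods N⟩

/-- **A `CyclotomeTower l E` EXISTS at `modelχ′`** over every cofinal chain `E ∋ 1` (`l ≥ 1`).
[cite: MochizukiEtTh2009, Cor 2.19 (ii) p.64] -/
theorem modelχ'_nonempty_cyclotomeTower {l : ℕ} (hl : 0 < l) {E : Set ℕ+} (one_mem : (1 : ℕ+) ∈ E)
    (cofinal : ∀ n : ℕ+, ∃ M ∈ E, n ∣ M) (total : ∀ M ∈ E, ∀ M' ∈ E, M ∣ M' ∨ M' ∣ M) :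
    Nonempty ((ThetaSetting.modelχ' p).CyclotomeTower l E) := by
  obtain ⟨mods, hmods⟩ := modelχ'_exists_cyclotomeMod_family p hl
  exact ⟨ThetaSetting.CyclotomeTower.ofAllLevels mods hmods one_mem cofinal total⟩

/-- **JOINT SATISFIABILITY WITH A CUSP**: one theta setting which is an EtTh-origin, HAS A CUSP, satisfies `hYcl`,
has `Δ_Θ` compact and `aug` open, and carries `CyclotomeMod l N` at every level and a `CyclotomeTower l E` over every
cofinal chain `E ∋ 1` (`l ≥ 1`). [cite: MochizukiEtTh2009, Cor 2.19 (ii) p.64] -/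
theorem exists_isEtThOrigin_and_isCusp_and_hYcl_and_isCompact_and_cyclotomeTower {l : ℕ} (hl : 0 < l) {E : Set ℕ+}
    (one_mem : (1 : ℕ+) ∈ E) (cofinal : ∀ n : ℕ+, ∃ M ∈ E, n ∣ M)
    (total : ∀ M ∈ E, ∀ M' ∈ E, M ∣ M' ∨ M' ∣ M) :
    ∃ D : ThetaSetting p, D.IsEtThOrigin ∧ (∃ x : D.Pt, D.IsCusp x) ∧
      (D.DtpY.map D.toHat.toMonoidHom).topologicalClosure ≤
        D.DtpY.map D.toHat.toMonoidHom ⊔ (⁅⁅D.DeltaHat, D.DeltaHat⁆, D.DeltaHat⁆).topologicalClosure ∧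
      IsCompact (D.DeltaTheta : Set D.GtpTheta) ∧ IsOpenMap D.aug ∧
      (∀ N : ℕ+, Nonempty (D.CyclotomeMod l N)) ∧ Nonempty (D.CyclotomeTower l E) :=
  ⟨ThetaSetting.modelχ' p, ThetaSetting.modelχ'_isEtThOrigin p, exists_isCusp_modelχ' p, hYcl_modelχ' p,
    isCompact_deltaTheta_modelχ' p, isOpenMap_aug_modelχ' p, modelχ'_nonempty_cyclotomeMod p hl,
    modelχ'_nonempty_cyclotomeTower p hl one_mem cofinal total⟩

end Literature.AnabelianGeometry.EtaleTheta.SettingModel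

end
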